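import Summits.QuantumFields.YangMills.Theorems.FluctuationComparisonRegPrIntLWregChain
import Summits.QuantumFields.YangMills.Theorems.BalabanUVNodesN09OneBondChartRead
import Literature.MathematicalPhysics.QuantumFieldTheory.Balaban1983to89.HaarExpChartLocalFaceTransport
import HarnessLib

/-!
# CHART² (C2-b): the one-variable CHAIN of the iterated (0.4) averaging, read in exponential charts, is `C^∞` at its base point with ONTO derivative

Definition-free helper for LINE g18-1 `Cruxes/FluctuationComparisonRegPrIntL/Lines/semiclassical_s2beta.lean` (crux `stmt-QuantumFields-20520`, row
LAPLACE; the `ContDiffAt` half (C2) of the v8 stub `stub_transversalHessian`, px11 g10 LOCATE-TRANSVERSAL-HESSIAN: «`y ↦ ϑ c (σ y) v` is `C^∞`» is an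
implicit-function statement for the chain `(environment, pivot) ↦ Ū⁽ⁿ⁾(U[βₙ c ↦ g])(c)`; its two analytic inputs are (C2-a) joint smoothness and (C2-b) an
INVERTIBLE PIVOT-DERIVATIVE).  THIS FILE = (C2-b), generic `(P, N)`:

★★ `chainRead_contDiffAt_surjective` — for a fine field `U` with small loop history below level `n` (`dist1 (loopHol (Ū⁽ᵏ⁾U) c′ i) ≤ α`, `k < n`, with
`α ≤ 1∕24`, `α < δ_N`, `157·α < L^{1−d}`) and a coarse bond `c : PBond P n`: (i) the chain `g ↦ chainMap ℰ n U c g` is continuous at its own private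
coordinate `U (βₙ c)`; (ii) its CHART-READ `Ψ : X ↦ Λ (chainMap ℰ n U c (Θ X · U (βₙ c)) · (Ū⁽ⁿ⁾U (c))⁻¹)` (exponential charts `Θ = expChart`,
`Λ = logChart` of `SU(N)` centred at the private coordinate and at its image `Ū⁽ⁿ⁾U(c) = chainMap ℰ n U c (U (βₙ c))`) is `C^∞` at `0`; (iii) the derivative
`DΨ(0) : 𝔰𝔲(N) → 𝔰𝔲(N)` is ONTO (hence a linear automorphism).  Proof: induction on `n` along ✓`chainMap_succ` — the chart-read of level `n+1` is,
near `0`, N09's ONE-BOND chart-read at the environment `Ū⁽ⁿ⁾U` (✓`…N09OneBondChartRead.contDiffAt_oneBond`, ✓`oneBond_fderiv_surjective`) composed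
with the level-`n` chart-read (chart identities `Θ ∘ Λ = id` near `1`, ✓`expChart_logChart`); derivatives compose, surjections compose.
★ `isInvertible_fderiv_chainRead` — the same derivative packaged as `ContinuousLinearMap.IsInvertible` (the displayed hypothesis `hinv` of
w5-20520 g14's (C2-c) `contDiffAt_coeField_resolve`).

HONEST: a count-neutral regularity letter on the tree's own averaging; (C2-a) (joint smoothness in the environment) and (C2-c) (the implicit-function
assembly) are NOT here; nothing of LAPLACE ∕ S2β ∕ crux 20520 is proved; rung R3 (YM₃ on T³) is NOT d = 4, NOT infinite volume, NOT a mass gap, NOT Clay;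
the Yang–Mills mass gap is NOT proved.
-/

noncomputable section

open scoped Matrix.Norms.L2Operator Topology ContDiff
open Filter Set Function
open Literature.MathematicalPhysics.QuantumFieldTheory.Balaban1983to89
open Literature.MathematicalPhysics.QuantumFieldTheory.Balaban1983to89.HaarExponentialChart
open Literature.MathematicalPhysics.QuantumFieldTheory.Balaban1983to89.HaarExponentialChart.IsChartRep
open Literature.MathematicalPhysics.QuantumFieldTheory.Balaban1983to89.BlockAveraging (Small Idx avgFun loopHol)
open Literature.MathematicalPhysics.QuantumFieldTheory.Balaban1983to89.BlockAveragingHaarAC (centralBond)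
open Literature.MathematicalPhysics.QuantumFieldTheory.Balaban1983to89.ExpMeanLog (expMeanLogSU deltaSU)
open Literature.MathematicalPhysics.QuantumFieldTheory.Balaban1983to89.Node00 (SU)
open Literature.MathematicalPhysics.QuantumLattice (fundamentalRep)
open Summit.QuantumFields.YangMills.BalabanUVNodes.N09ChartReadAveragingSmooth (continuousAt_avgFun_of_small)
open Summit.QuantumFields.YangMills.BalabanUVNodes.N09OneBondChartRead (contDiffAt_oneBond oneBond_fderiv_surjective)
open Summit.QuantumFields.YangMills.Theorems.FluctuationComparisonRegPrIntLWregChain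

namespace Summit.QuantumFields.YangMills.Theorems.FluctuationComparisonRegPrIntLS2BetaChainDerivative

variable {P : Params} {N : ℕ} [NeZero N]

/-- `Λ(Θ X) = X` eventually near `0` (the chart identity on the ball of radius `s_C`). [cite: Helgason2000, Ch. I §1 Thm. 1.14 (13) p. 96] -/
theorem eventually_logChart_expChart :
    ∀ᶠ X : (specialUnitaryLogChart (Fin N)).lie in 𝓝 0,
      (isChartRep_specialUnitaryGroup (n := Fin N)).logChart ((isChartRep_specialUnitaryGroup (n := Fin N)).expChart X) = X := by
  filter_upwards [Metric.ball_mem_nhds (0 : (specialUnitaryLogChart (Fin N)).lie) (chartRadius_pos (C := specialUnitaryLogChart (Fin N)))]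
    with X hX
  exact (isChartRep_specialUnitaryGroup (n := Fin N)).logChart_expChart (mem_ball_zero_iff.1 hX)

/-- The chart-identity neighbourhood of `1`: `{g | ‖ρ g − 1‖ < r_C}` is an open neighbourhood of `1` in `SU(N)`, on which `Θ(Λ g) = g`.
[cite: Helgason2000, Ch. I §1 Thm. 1.14 (13) p. 96] -/
theorem chartNhd_mem_nhds_one :
    {g : SU N | ‖fundamentalRep (Fin N) g - 1‖ < innerRadius (specialUnitaryLogChart (Fin N))} ∈ 𝓝 (1 : SU N) := by
  have hc : Continuous fun g : SU N => ‖fundamentalRep (Fin N) g - 1‖ :=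
    ((isChartRep_specialUnitaryGroup (n := Fin N)).continuous.sub continuous_const).norm
  refine (isOpen_lt hc continuous_const).mem_nhds ?_
  show ‖fundamentalRep (Fin N) (1 : SU N) - 1‖ < innerRadius (specialUnitaryLogChart (Fin N))
  rw [map_one, sub_self, norm_zero]
  exact innerRadius_pos

/-- ★★ **(C2-b) THE CHAIN'S CHART-READ IS `C^∞` AT ITS BASE POINT WITH ONTO DERIVATIVE** (and the chain is continuous at its private coordinate): for
`n ≤ m + K`, a fine field `U` with small loop history below level `n` and a coarse bond `c : PBond P n` — see the module docstring.  Induction on `n`: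
level `0` is the identity chart-read; level `n + 1` is, near `0`, the one-bond chart-read of the (0.4) average at the environment `Ū⁽ⁿ⁾U` and bond `c`
(N09 ✓`contDiffAt_oneBond`, ✓`oneBond_fderiv_surjective`) composed with the level-`n` chart-read at the bond `centralBond c` (✓`chainMap_succ`).
[cite: Balaban1987RG1, (0.4) p.253 and p.267 («B′(b₀(c)) can be expressed in terms of the remaining variables»); Balaban1985Averaging, Prop. 3 (124) p.36;
Helgason2000, Ch. I §1 Thm. 1.14 (13) p. 96] -/
theorem chainRead_contDiffAt_surjective {α : ℝ} (hα24 : α ≤ 1 / 24) (hαδ : α < deltaSU (Fin N))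
    (hαL : 157 * α < ((P.L : ℝ) ^ (P.d - 1))⁻¹) :
    ∀ {n : ℕ}, n ≤ P.m + P.K → ∀ (U : GaugeField P 0 (SU N)) (c : PBond P n),
      (∀ k, k < n → ∀ (c' : PBond P (k + 1)) (i : Idx P),
        dist1 (loopHol (Averaging.iter (fun i => BlockAveraging.blockAvg (P := P) (j := i) (expMeanLogSU (n := Fin N))) k U) c' i) ≤ α) →
      ContinuousAt (fun g : SU N => chainMap (expMeanLogSU (n := Fin N)) n U c g) (U (iterCentralBond n c)) ∧
      ContDiffAt ℝ ⊤ (fun X : (specialUnitaryLogChart (Fin N)).lie =>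
        (isChartRep_specialUnitaryGroup (n := Fin N)).logChart
          (chainMap (expMeanLogSU (n := Fin N)) n U c ((isChartRep_specialUnitaryGroup (n := Fin N)).expChart X * U (iterCentralBond n c)) *
            (Averaging.iter (fun i => BlockAveraging.blockAvg (P := P) (j := i) (expMeanLogSU (n := Fin N))) n U c)⁻¹)) 0 ∧
      Function.Surjective (fderiv ℝ (fun X : (specialUnitaryLogChart (Fin N)).lie =>
        (isChartRep_specialUnitaryGroup (n := Fin N)).logChart
          (chainMap (expMeanLogSU (n := Fin N)) n U c ((isChartRep_specialUnitaryGroup (n := Fin N)).expChart X * U (iterCentralBond n c)) *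
            (Averaging.iter (fun i => BlockAveraging.blockAvg (P := P) (j := i) (expMeanLogSU (n := Fin N))) n U c)⁻¹)) 0) := by
  intro n
  induction n with
  | zero =>
      intro _ U c _
      -- level 0: the chain is the identity, the chart-read is `Λ ∘ Θ = id` near `0`
      have hid : (fun X : (specialUnitaryLogChart (Fin N)).lie =>
          (isChartRep_specialUnitaryGroup (n := Fin N)).logChart
            (chainMap (expMeanLogSU (n := Fin N)) 0 U c ((isChartRep_specialUnitaryGroup (n := Fin N)).expChart X * U (iterCentralBond 0 c)) *
              (Averaging.iter (fun i => BlockAveraging.blockAvg (P := P) (j := i) (expMeanLogSU (n := Fin N))) 0 U c)⁻¹)) =ᶠ[𝓝 0] id := by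
        filter_upwards [eventually_logChart_expChart (N := N)] with X hX
        simp only [chainMap_zero, iterCentralBond_zero, id]
        show (isChartRep_specialUnitaryGroup (n := Fin N)).logChart
          ((isChartRep_specialUnitaryGroup (n := Fin N)).expChart X * U c * (U c)⁻¹) = X
        rw [mul_inv_cancel_right, hX]
      refine ⟨?_, contDiffAt_id.congr_of_eventuallyEq hid, ?_⟩
      · simp only [chainMap_zero]
        exact continuousAt_id
      · rw [hid.fderiv_eq, fderiv_id]
        exact fun Y => ⟨Y, rfl⟩
  | succ n ih =>
      intro hn U c hhist
      have hn' : n ≤ P.m + P.K := by omega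
      obtain ⟨ihc, ihd, ihs⟩ := ih hn' U (centralBond c) fun k hk c' i => hhist k (by omega) c' i
      -- the environment `W = Ū⁽ⁿ⁾U`, kept opaque
      obtain ⟨W, hW⟩ : ∃ W : GaugeField P n (SU N), W = Averaging.iter (fun i => BlockAveraging.blockAvg (P := P) (j := i) (expMeanLogSU (n := Fin N))) n U := ⟨_, rfl⟩
      set H := isChartRep_specialUnitaryGroup (n := Fin N) with hH
      -- the guards at the environment
      have hαW : ∀ (c' : PBond P (n + 1)) (i : Idx P), dist1 (loopHol W c' i) ≤ α := fun c' i => by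
        rw [hW]; exact hhist n (by omega) c' i
      have hsmallW : ∀ c' : PBond P (n + 1), Small (expMeanLogSU (n := Fin N)) W c' := fun c' i => lt_of_le_of_lt (hαW c' i) hαδ
      -- the one-bond chart-read at `(W, c)` (N09)
      have hφd := contDiffAt_oneBond (P := P) (j := n) W c hsmallW
      have hφs := oneBond_fderiv_surjective (P := P) (j := n) W c hn hsmallW (hαW c) hα24 hαδ hαL
      -- bookkeeping identities
      have hβ : iterCentralBond (n + 1) c = iterCentralBond n (centralBond c) := rfl
      have hWn1 : Averaging.iter (fun i => BlockAveraging.blockAvg (P := P) (j := i) (expMeanLogSU (n := Fin N))) (n + 1) U c = avgFun (expMeanLogSU (n := Fin N)) W c := by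
        rw [hW]; rfl
      have hWc : Averaging.iter (fun i => BlockAveraging.blockAvg (P := P) (j := i) (expMeanLogSU (n := Fin N))) n U (centralBond c) = W (centralBond c) := by rw [hW]
      have hsucc : ∀ g : SU N, chainMap (expMeanLogSU (n := Fin N)) (n + 1) U c g =
          avgFun (expMeanLogSU (n := Fin N)) (Function.update W (centralBond c) (chainMap (expMeanLogSU (n := Fin N)) n U (centralBond c) g)) c := by
        intro g; rw [chainMap_succ _ hn U c, ← hW]
      have hself : chainMap (expMeanLogSU (n := Fin N)) n U (centralBond c) (U (iterCentralBond n (centralBond c))) = W (centralBond c) := by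
        rw [chainMap_self, hWc]
      -- (i) continuity of the chain at the private coordinate
      have hcont : ContinuousAt (fun g : SU N => chainMap (expMeanLogSU (n := Fin N)) (n + 1) U c g) (U (iterCentralBond (n + 1) c)) := by
        have heq : (fun g : SU N => chainMap (expMeanLogSU (n := Fin N)) (n + 1) U c g) =
            fun g => avgFun (expMeanLogSU (n := Fin N))
              (Function.update W (centralBond c) (chainMap (expMeanLogSU (n := Fin N)) n U (centralBond c) g)) c := funext hsucc
        rw [heq, hβ]
        have hup : ContinuousAt (fun g : SU N => Function.update W (centralBond c)
            (chainMap (expMeanLogSU (n := Fin N)) n U (centralBond c) g)) (U (iterCentralBond n (centralBond c))) :=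
          ContinuousAt.update (f := fun _ : SU N => W) continuousAt_const (centralBond c) ihc
        have h0 : Function.update W (centralBond c)
            (chainMap (expMeanLogSU (n := Fin N)) n U (centralBond c) (U (iterCentralBond n (centralBond c)))) = W := by
          rw [hself, Function.update_eq_self]
        have havg : ContinuousAt (fun V : GaugeField P n (SU N) => avgFun (expMeanLogSU (n := Fin N)) V c)
            (Function.update W (centralBond c)
              (chainMap (expMeanLogSU (n := Fin N)) n U (centralBond c) (U (iterCentralBond n (centralBond c))))) := by
          rw [h0]; exact (continuousAt_pi.1 (continuousAt_avgFun_of_small (P := P) (j := n) W hsmallW)) c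
        have hres := ContinuousAt.comp (f := fun g : SU N => Function.update W (centralBond c)
            (chainMap (expMeanLogSU (n := Fin N)) n U (centralBond c) g)) (x := U (iterCentralBond n (centralBond c))) havg hup
        simp only [Function.comp_def] at hres
        exact hres
      -- the level-`n` chain value near `X = 0` stays in the chart-identity neighbourhood of `W (centralBond c)`
      have hlim : Tendsto (fun X : (specialUnitaryLogChart (Fin N)).lie =>
          chainMap (expMeanLogSU (n := Fin N)) n U (centralBond c) (H.expChart X * U (iterCentralBond n (centralBond c))) *
            (W (centralBond c))⁻¹) (𝓝 0) (𝓝 1) := by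
        have hT : Tendsto (fun g : SU N => chainMap (expMeanLogSU (n := Fin N)) n U (centralBond c) g)
            (𝓝 (U (iterCentralBond n (centralBond c)))) (𝓝 (W (centralBond c))) := by
          rw [← hself]; exact ihc
        have hT1 : Tendsto (fun X : (specialUnitaryLogChart (Fin N)).lie => H.expChart X * U (iterCentralBond n (centralBond c)))
            (𝓝 0) (𝓝 (U (iterCentralBond n (centralBond c)))) := by
          have h := ((H.continuous_expChart).tendsto (0 : (specialUnitaryLogChart (Fin N)).lie)).mul_const (U (iterCentralBond n (centralBond c)))
          simp only [H.expChart_zero, one_mul] at h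
          exact h
        have h := (hT.comp hT1).mul_const ((W (centralBond c))⁻¹)
        simp only [Function.comp_def, mul_inv_cancel] at h
        exact h
      have hev : ∀ᶠ X : (specialUnitaryLogChart (Fin N)).lie in 𝓝 0,
          H.expChart (H.logChart (chainMap (expMeanLogSU (n := Fin N)) n U (centralBond c)
              (H.expChart X * U (iterCentralBond n (centralBond c))) * (W (centralBond c))⁻¹)) =
            chainMap (expMeanLogSU (n := Fin N)) n U (centralBond c) (H.expChart X * U (iterCentralBond n (centralBond c))) *
              (W (centralBond c))⁻¹ := by
        filter_upwards [hlim (chartNhd_mem_nhds_one (N := N))] with X hX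
        exact H.expChart_logChart hX
      -- the level-`(n+1)` chart-read is, near `0`, the one-bond chart-read composed with the level-`n` chart-read
      have hcomp : (fun X : (specialUnitaryLogChart (Fin N)).lie =>
          H.logChart (chainMap (expMeanLogSU (n := Fin N)) (n + 1) U c (H.expChart X * U (iterCentralBond (n + 1) c)) *
            (Averaging.iter (fun i => BlockAveraging.blockAvg (P := P) (j := i) (expMeanLogSU (n := Fin N))) (n + 1) U c)⁻¹)) =ᶠ[𝓝 0]
          (fun Y : (specialUnitaryLogChart (Fin N)).lie =>
            H.logChart (avgFun (expMeanLogSU (n := Fin N))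
              (fun b => H.expChart ((Pi.single (centralBond c) Y : PBond P n → (specialUnitaryLogChart (Fin N)).lie) b) * W b) c *
                (avgFun (expMeanLogSU (n := Fin N)) W c)⁻¹)) ∘
          (fun X : (specialUnitaryLogChart (Fin N)).lie =>
            H.logChart (chainMap (expMeanLogSU (n := Fin N)) n U (centralBond c)
              (H.expChart X * U (iterCentralBond n (centralBond c))) *
                (Averaging.iter (fun i => BlockAveraging.blockAvg (P := P) (j := i) (expMeanLogSU (n := Fin N))) n U (centralBond c))⁻¹)) := by
        filter_upwards [hev] with X hX
        have henv : Function.update W (centralBond c)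
            (chainMap (expMeanLogSU (n := Fin N)) n U (centralBond c) (H.expChart X * U (iterCentralBond n (centralBond c)))) =
            fun b => H.expChart ((Pi.single (centralBond c)
              (H.logChart (chainMap (expMeanLogSU (n := Fin N)) n U (centralBond c)
                (H.expChart X * U (iterCentralBond n (centralBond c))) * (W (centralBond c))⁻¹)) : PBond P n → (specialUnitaryLogChart (Fin N)).lie) b) * W b := by
          funext b
          by_cases hb : b = centralBond c
          · subst hb
            rw [Function.update_self, Pi.single_eq_same, hX, inv_mul_cancel_right]
          · rw [Function.update_of_ne hb, Pi.single_eq_of_ne hb, H.expChart_zero, one_mul]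
        simp only [Function.comp_def]
        rw [hβ, hWn1, hWc, hsucc, henv]
      -- value of the level-`n` chart-read at `0`
      have hΨ0 : H.logChart (chainMap (expMeanLogSU (n := Fin N)) n U (centralBond c)
            (H.expChart 0 * U (iterCentralBond n (centralBond c))) *
              (Averaging.iter (fun i => BlockAveraging.blockAvg (P := P) (j := i) (expMeanLogSU (n := Fin N))) n U (centralBond c))⁻¹) = 0 := by
        rw [H.expChart_zero, one_mul, chainMap_self, mul_inv_cancel]
        exact H.logChart_one
      have hφd' : ContDiffAt ℝ ⊤ (fun Y : (specialUnitaryLogChart (Fin N)).lie =>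
          H.logChart (avgFun (expMeanLogSU (n := Fin N))
            (fun b => H.expChart ((Pi.single (centralBond c) Y : PBond P n → (specialUnitaryLogChart (Fin N)).lie) b) * W b) c *
              (avgFun (expMeanLogSU (n := Fin N)) W c)⁻¹))
          (H.logChart (chainMap (expMeanLogSU (n := Fin N)) n U (centralBond c)
            (H.expChart 0 * U (iterCentralBond n (centralBond c))) *
              (Averaging.iter (fun i => BlockAveraging.blockAvg (P := P) (j := i) (expMeanLogSU (n := Fin N))) n U (centralBond c))⁻¹)) := by
        rw [hΨ0]; exact hφd
      have hφs' : Function.Surjective (fderiv ℝ (fun Y : (specialUnitaryLogChart (Fin N)).lie =>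
          H.logChart (avgFun (expMeanLogSU (n := Fin N))
            (fun b => H.expChart ((Pi.single (centralBond c) Y : PBond P n → (specialUnitaryLogChart (Fin N)).lie) b) * W b) c *
              (avgFun (expMeanLogSU (n := Fin N)) W c)⁻¹))
          (H.logChart (chainMap (expMeanLogSU (n := Fin N)) n U (centralBond c)
            (H.expChart 0 * U (iterCentralBond n (centralBond c))) *
              (Averaging.iter (fun i => BlockAveraging.blockAvg (P := P) (j := i) (expMeanLogSU (n := Fin N))) n U (centralBond c))⁻¹))) := by
        rw [hΨ0]; exact hφs
      have hd := hφd'.comp 0 ihd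
      refine ⟨hcont, hd.congr_of_eventuallyEq hcomp, ?_⟩
      -- (iii) the derivative is the composite of two surjections
      rw [hcomp.fderiv_eq, fderiv_comp 0 (hφd'.differentiableAt (by simp)) (ihd.differentiableAt (by simp))]
      intro Z
      obtain ⟨Y, hY⟩ := hφs' Z
      obtain ⟨X, hX⟩ := ihs Y
      refine ⟨X, ?_⟩
      rw [ContinuousLinearMap.coe_comp, Function.comp_apply, hX]
      exact hY

/-- ★ **(C2-b) IN THE `IsInvertible` SHAPE** (the displayed hypothesis `hinv` of w5-20520 g14's (C2-c) `contDiffAt_coeField_resolve`): under the same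
guards, the derivative at `0` of the chain's chart-read `X ↦ Λ (chainMap ℰ n U c (Θ X · U (βₙ c)) · (Ū⁽ⁿ⁾U c)⁻¹)` is an INVERTIBLE continuous linear
endomorphism of `𝔰𝔲(N)` (onto by `chainRead_contDiffAt_surjective`, hence bijective in finite dimension, packaged as a `ContinuousLinearEquiv`).
[cite: Balaban1987RG1, (0.4) p.253 and p.267; Balaban1985Averaging, Prop. 3 (124) p.36] -/
theorem isInvertible_fderiv_chainRead {α : ℝ} (hα24 : α ≤ 1 / 24) (hαδ : α < deltaSU (Fin N))
    (hαL : 157 * α < ((P.L : ℝ) ^ (P.d - 1))⁻¹) {n : ℕ} (hn : n ≤ P.m + P.K) (U : GaugeField P 0 (SU N)) (c : PBond P n)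
    (hhist : ∀ k, k < n → ∀ (c' : PBond P (k + 1)) (i : Idx P),
      dist1 (loopHol (Averaging.iter (fun i => BlockAveraging.blockAvg (P := P) (j := i) (expMeanLogSU (n := Fin N))) k U) c' i) ≤ α) :
    (fderiv ℝ (fun X : (specialUnitaryLogChart (Fin N)).lie =>
        (isChartRep_specialUnitaryGroup (n := Fin N)).logChart
          (chainMap (expMeanLogSU (n := Fin N)) n U c ((isChartRep_specialUnitaryGroup (n := Fin N)).expChart X * U (iterCentralBond n c)) *
            (Averaging.iter (fun i => BlockAveraging.blockAvg (P := P) (j := i) (expMeanLogSU (n := Fin N))) n U c)⁻¹)) 0).IsInvertible := by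
  haveI : FiniteDimensional ℝ (specialUnitaryLogChart (Fin N)).lie := inferInstance
  set f := fderiv ℝ (fun X : (specialUnitaryLogChart (Fin N)).lie =>
        (isChartRep_specialUnitaryGroup (n := Fin N)).logChart
          (chainMap (expMeanLogSU (n := Fin N)) n U c ((isChartRep_specialUnitaryGroup (n := Fin N)).expChart X * U (iterCentralBond n c)) *
            (Averaging.iter (fun i => BlockAveraging.blockAvg (P := P) (j := i) (expMeanLogSU (n := Fin N))) n U c)⁻¹)) 0 with hf
  have hsurj : Function.Surjective f := (chainRead_contDiffAt_surjective (P := P) (N := N) hα24 hαδ hαL hn U c hhist).2.2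
  have hsurj' : Function.Surjective (f : (specialUnitaryLogChart (Fin N)).lie →ₗ[ℝ] (specialUnitaryLogChart (Fin N)).lie) := hsurj
  have hinj : Function.Injective (f : (specialUnitaryLogChart (Fin N)).lie →ₗ[ℝ] (specialUnitaryLogChart (Fin N)).lie) := LinearMap.injective_iff_surjective.2 hsurj'
  refine ⟨(LinearEquiv.ofBijective (f : (specialUnitaryLogChart (Fin N)).lie →ₗ[ℝ] (specialUnitaryLogChart (Fin N)).lie) ⟨hinj, hsurj'⟩).toContinuousLinearEquiv, ?_⟩
  ext X
  rfl

end Summit.QuantumFields.YangMills.Theorems.FluctuationComparisonRegPrIntLS2BetaChainDerivative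

end
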